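import Literature.Algebra.Lie.SymplecticSymmetricSquares
import Literature.Algebra.Lie.SymplecticBireflectionGrading
import Mathlib.LinearAlgebra.Trace
import HarnessLib

/-!
# BL, step (b): the trace form pairs `𝔤^{i}` with `𝔤^{−i}` — a root `s_{u v₊} ∈ 𝔤` has a partner `s_{w v₋} ∈ 𝔤` with `ω(u, w) ≠ 0`
(Katz, *ESDE* Ch. 1, proof of Thm. 1.0: the `Ad`-grading of `𝒢` by a normalising semisimple element; Humphreys §6.2: the trace form)

Setting: the bireflection datum of `SymplecticBireflectionGrading` (`ω` alternating, `ω(v₊, v₋) = 1`, `γ v₊ = i v₊`, `γ v₋ = −i v₋`,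
`γ = 1` on `U`, `i² = −1`, `2 ≠ 0`), a subspace `L ≤ End(M)` of `ω`-skew operators stable under `Ad γ : X ↦ γ X γ⁻¹`, on which the
trace form `(X, Y) ↦ tr(X Y)` is non-degenerate (hypothesis `hτ`; for a semisimple Lie subalgebra this is
`TraceFormFaithful.traceForm_nondegenerate`, Humphreys §6.2).

* `trace_mul_eq_zero_of_conj` — `tr` is `Ad γ`-invariant, so `tr(N Z) = 0` for `Ad γ`-eigen-operators `N`, `Z` with eigenvalues
  `i`, `μ` unless `i μ = 1`;
* **`exists_partner_of_symSq_mem`** — if `s_{u v₊} ∈ L` with `0 ≠ u ∈ U`, there is `w ∈ U` with `s_{w v₋} ∈ L` and `ω(u, w) ≠ 0`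
  (the `−i`-component `Z` of a trace-form partner of `s_{u v₊}` satisfies `tr(s_{u v₊} Z) ≠ 0`, is `s_{w v₋}` by (G3′), and
  `tr(s_{u v₊} s_{w v₋}) = −2 ω(u, w)`).
THEOREMS only; the Hodge cell's crux K1Q consumes it in lemma BL. [cite: Katz1990ESDE, Ch. 1, proof of Thm. 1.0 (p. 9)]
-/

namespace Literature.Algebra.Lie

namespace SymplecticBireflection

open Module
open LinearMap (BilinForm)
open SymplecticSymmetricSquares

variable {K : Type*} [Field K] {V : Type*} [AddCommGroup V] [Module K V] [FiniteDimensional K V]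

omit [FiniteDimensional K V] in
/-- **`tr` is `Ad γ`-invariant, so eigen-operators with eigenvalues `λ`, `μ`, `λ μ ≠ 1`, are trace-orthogonal**:
if `γ N γ⁻¹ = λ N` and `γ Z γ⁻¹ = μ Z` then `(1 − λ μ) tr(N Z) = 0`. [cite: Katz1990ESDE, Ch. 1, proof of Thm. 1.0 (p. 9)] -/
theorem one_sub_mul_mul_trace_mul_eq_zero (γ : V ≃ₗ[K] V) {N Z : Module.End K V} {l μ : K} (hN : γ.conj N = l • N)
    (hZ : γ.conj Z = μ • Z) : (1 - l * μ) * LinearMap.trace K V (N * Z) = 0 := by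
  have h1 : LinearMap.trace K V (γ.conj (N * Z)) = LinearMap.trace K V (N * Z) := LinearMap.trace_conj' _ _
  have h2 : γ.conj (N * Z) = (l * μ) • (N * Z) := by
    rw [Module.End.mul_eq_comp, LinearEquiv.conj_comp, hN, hZ]
    rw [LinearMap.smul_comp, LinearMap.comp_smul, smul_smul]
  rw [h2, map_smul, smul_eq_mul] at h1
  linear_combination -h1

section Pairing

variable {ω : BilinForm K V} (hω : ω.IsAlt) {i : K} (hi : i * i = -1) (h2 : (2 : K) ≠ 0) {vp vm : V} (hpm : ω vp vm = 1)
  {γ : V ≃ₗ[K] V} (hγp : γ vp = i • vp) (hγm : γ vm = (-i) • vm) (hγU : ∀ x, ω x vp = 0 → ω x vm = 0 → γ x = x)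
  (hγω : ∀ x y, ω (γ x) (γ y) = ω x y)

include hω hi h2 hpm hγp hγm hγU hγω in
/-- **BL (b): a root `s_{u v₊} ∈ L` has a partner `s_{w v₋} ∈ L` with `ω(u, w) ≠ 0`.** `L ≤ End(M)` a subspace of `ω`-skew
operators, `Ad γ`-stable, with non-degenerate trace form (`hτ`); `γ` an `ω`-isometry; `0 ≠ u ∈ U` with `s_{u v₊} ∈ L`. Then some `w ∈ U` has
`s_{w v₋} ∈ L` and `ω(u, w) ≠ 0`. [cite: Katz1990ESDE, Ch. 1, proof of Thm. 1.0 (p. 9)] -/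
theorem exists_partner_of_symSq_mem (L : Submodule K (Module.End K V)) (hL : ∀ X ∈ L, γ.conj X ∈ L)
    (hskew : ∀ X ∈ L, ∀ x y, ω (X x) y = -ω x (X y))
    (hτ : ∀ X ∈ L, (∀ Y ∈ L, LinearMap.trace K V (X * Y) = 0) → X = 0)
    {u : V} (hup : ω u vp = 0) (hum : ω u vm = 0) (hu : u ≠ 0) (huL : symSq ω u vp ∈ L) :
    ∃ w : V, (ω w vp = 0 ∧ ω w vm = 0) ∧ symSq ω w vm ∈ L ∧ ω u w ≠ 0 := by
  set A := γ.conj with hAdef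
  set N := symSq ω u vp with hNdef
  have hmp : ω vm vp = -1 := apply_minus_plus hω hpm
  -- `N ≠ 0` (`N v₋ = −u`) and `Ad γ N = i N`
  have hvu : ω vm u = 0 := by rw [← LinearMap.IsAlt.neg hω u vm, hum, neg_zero]
  have hN0 : N ≠ 0 := by
    intro h
    have := congrArg (fun T : Module.End K V => T vm) h
    simp only [hNdef, symSq_apply, hmp, hvu, zero_smul, zero_add, neg_one_smul, LinearMap.zero_apply, neg_eq_zero] at this
    exact hu this
  have hAN : A N = i • N := by
    rw [hAdef, conj_eq_mul, hNdef, conj_symSq ω hγω, hγp, hγU u hup hum, symSq_comm, symSq_smul_left, symSq_comm]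
  -- a trace-form partner `Y`, decomposed along the order-4 projectors of `Ad γ`
  have hA4 : ∀ X, A (A (A (A X))) = X := conj_conj_conj_conj hω hi hpm hγp hγm hγU
  by_contra hcon
  apply hN0
  refine hτ N huL fun Y hY => ?_
  -- the four components
  set Q1 := Y + A Y + A (A Y) + A (A (A Y)) with hQ1
  set Qi := Y - i • A Y - A (A Y) + i • A (A (A Y)) with hQi
  set Qm1 := Y - A Y + A (A Y) - A (A (A Y)) with hQm1
  set Qmi := Y + i • A Y - A (A Y) - i • A (A (A Y)) with hQmi
  have h4Y : (4 : K) • Y = Q1 + Qi + Qm1 + Qmi := by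
    rw [hQ1, hQi, hQm1, hQmi]
    have : (4 : K) • Y = Y + Y + Y + Y := by
      have e : (4 : K) = 1 + 1 + 1 + 1 := by norm_num
      rw [e, add_smul, add_smul, add_smul, one_smul]
    rw [this]; module
  have hAQ1 : A Q1 = (1 : K) • Q1 := by rw [one_smul, hQ1]; simp only [map_add, hA4]; abel
  have hAQi : A Qi = i • Qi := by
    rw [hQi]; simp only [map_add, map_sub, map_smul, hA4, smul_add, smul_sub, smul_smul, hi, neg_smul, one_smul]; abel
  have hAQm1 : A Qm1 = (-1 : K) • Qm1 := by
    rw [neg_one_smul, hQm1]; simp only [map_add, map_sub, hA4, neg_sub]; abel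
  have hAQmi : A Qmi = (-i) • Qmi := by
    rw [hQmi]; simp only [map_add, map_sub, map_smul, hA4, smul_add, smul_sub, smul_smul, hi, neg_smul, one_smul, neg_mul,
      neg_neg]; abel
  -- three of the four pairings vanish by `Ad γ`-invariance of the trace
  have hI1 : i ≠ 1 := I_ne_one hi h2
  have t1 : LinearMap.trace K V (N * Q1) = 0 := by
    have := one_sub_mul_mul_trace_mul_eq_zero γ hAN hAQ1
    rw [mul_one] at this
    exact (mul_eq_zero.1 this).resolve_left (sub_ne_zero.2 hI1.symm)
  have ti : LinearMap.trace K V (N * Qi) = 0 := by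
    have := one_sub_mul_mul_trace_mul_eq_zero γ hAN hAQi
    rw [hi] at this
    exact (mul_eq_zero.1 this).resolve_left (by intro h; exact h2 (by linear_combination h))
  have tm1 : LinearMap.trace K V (N * Qm1) = 0 := by
    have := one_sub_mul_mul_trace_mul_eq_zero γ hAN hAQm1
    rw [mul_neg, mul_one] at this
    exact (mul_eq_zero.1 this).resolve_left (by intro h; exact I_ne_neg_one hi h2 (by linear_combination h))
  -- the `−i`-component is `s_{w v₋}` (G3′), and its pairing with `N` is `−2 ω(u, w)`, which vanishes by `hcon`
  have hQmiL : Qmi ∈ L := by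
    rw [hQmi]
    exact L.sub_mem (L.sub_mem (L.add_mem hY (L.smul_mem i (hL Y hY))) (hL _ (hL Y hY))) (L.smul_mem i (hL _ (hL _ (hL Y hY))))
  have hQmi' : ∀ z, γ (Qmi z) = (-i) • Qmi (γ z) := apply_apply_eq_of_conj_eq_smul (by rw [← hAdef]; exact hAQmi)
  obtain ⟨w, ⟨hwp, hwm⟩, hw⟩ := exists_eq_symSq_of_conj_eq_neg_I_smul hω hi h2 hpm hγp hγm hγU (hskew Qmi hQmiL) hQmi'
  have hQmi_eq : Qmi = symSq ω w vm := by ext z; rw [hw z, symSq_apply]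
  have tmi : LinearMap.trace K V (N * Qmi) = 0 := by
    have hw0 : ω u w = 0 := by
      by_contra h
      exact hcon ⟨w, ⟨hwp, hwm⟩, hQmi_eq ▸ hQmiL, h⟩
    rw [hQmi_eq, hNdef, trace_symSq_mul_symSq hω, hvu, hmp, hw0]
    ring
  -- hence `tr(N Y) = 0`
  have h4 : (4 : K) ≠ 0 := by
    have : (4 : K) = 2 * 2 := by norm_num
    rw [this]; exact mul_ne_zero h2 h2
  have := congrArg (fun T => LinearMap.trace K V (N * T)) h4Y
  simp only [mul_smul_comm, map_smul, smul_eq_mul, mul_add, map_add, t1, ti, tm1, tmi, add_zero] at this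
  exact (mul_eq_zero.1 this).resolve_left h4

end Pairing

end SymplecticBireflection

end Literature.Algebra.Lie
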